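import Summits.BirchSwinnertonDyer.BirchSwinnertonDyer.Theses.SemiOrdinaryEisensteinDescent
import Summits.BirchSwinnertonDyer.BirchSwinnertonDyer.Theorems.WildThreeRankOneBSDpOfGlobalDivisibilityStepL
import Summits.BirchSwinnertonDyer.BirchSwinnertonDyer.Theorems.KolyvaginRoadThreePointCertificate
import Summits.BirchSwinnertonDyer.BirchSwinnertonDyer.Theorems.KolyvaginRoadThreeLevelData
import Summits.BirchSwinnertonDyer.Rank1Residual.Additive.WildThreeDivisibilitySuffices
import Literature.NumberTheory.EllipticCurves.HeegnerPointsOfConductorRationalityProofs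
import Literature.NumberTheory.EllipticCurves.RingClassGalOverCyclicProofs
import Literature.NumberTheory.EllipticCurves.BSDRankZeroDensity
import HarnessLib

/-!
# Route `SemiOrdinaryEisensteinDescent`, crux Ko `WildKolyvaginUpperAtThree` (stmt-BirchSwinnertonDyer-20480), line
# `birth`: CLASS currency ⟹ POINT currency for the divisibility index, and Ko BY NAME from the line's research stub
# `stub_minftyGeManin` + Kolyvagin 1990 + Matar–Nekovář 2019 Thm. 0.7 (lead prover `bsd-wall-soed-p2` g0;
# `--supports stmt-BirchSwinnertonDyer-20480`; BSD is not proved by any of this)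

THE BRIDGE (`pDiv_of_minftyGe`, `globalDivisibility_of_minftyGe`; sorry-free, no named fact as hypothesis). The b2b
cell types the divisibility index of the Heegner-point Kolyvagin system at `p = 3` in CLASS currency —
`AdditiveThree.MinftyGe W K Dt β ι t`: every Kolyvagin class `c_M(n) ∈ H¹(K, E[3^M])` (`n` a square-free product of
Zhang–Kolyvagin primes, `1 ≤ M ≤ M(n)`) is `3^t`-divisible (W. Zhang 2014 §3.8 `𝓜(n)`) —, while the x11b3 / `bsd-wall`
receptacles (`SchneiderFree.Exact.upper_of_globalDivisibility_of_surj`, p542530; Matar–Nekovář's Thm. 0.7 as typed) read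
it in POINT currency — `Koly.PDiv d 3 s'`: `P(n) ∈ 3^{s'} E(K[n])` whenever every prime of `n` has index `≥ s'`
(McCallum 1991 `ord_p(P_n)`). CLASS ⟹ POINT at every depth `s' ≤ t`: read the class at the level `M = s'` itself —
`c_{s'}(n)` is `3^t`-divisible, hence `0` in the `3^{s'}`-torsion group `H¹(K, E[3^{s'}])` (`zsmul_galH1Torsion_eq_zero`);
it is McCallum's GENUINE class (admissibility of `E(K[n]) ⊆ E(K̄)` from `ρ̄_{E,3}` onto —
`RingClassNoTorsion.isAdmissible_pointsSubgroup_three`; `Γ_K`-invariance of `[P(n)]` mod `3^{s'}` at Zhang–Kolyvagin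
levels of index `≥ s'` — `KolyCert.toGeomPoints_derivedPoint_mem_invPoints_of_dvd_zhang`, fed with Kolyvagin–Heegner data
at the lower levels, which EXIST by the DISCHARGED Gross §3 facts `phi_heegnerPointOfConductor_mem_range_map_ringClassField_holds`
and `exists_generator_ringClassGalOver_holds` through `nonempty_kolyvaginHeegnerData_of_grossCM`), so McCallum's Cor. 4.5
(`KolyCert.kolyvaginClass_eq_zero_iff_pDiv`) gives `3^{s'} ∣ P(n)`. (POINT ⟹ CLASS at a fixed level is NOT formal and is
not claimed.)

CONSEQUENCES. `upper_of_minftyGe_of_surj`: on one frame, `MinftyGe … (ord₃ ∏ c_ℓ + s)` + Kolyvagin 1990 (`kolyvagin`, named,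
hypothesis) + Matar–Nekovář 2019 Thm. 0.7/§0.11 (named, hypothesis) ⟹ the socket `Upper.IndexUpperBoundLeAt W 3 K P s`.
`wildKolyvaginUpperAtThree_of_minftyGeManin`: the crux Ko BY NAME from the two named facts and the line's registered research
stub `stub_minftyGeManin` taken VERBATIM as a hypothesis (class currency, Manin slack `v₃ c(Dt)`) — the class-currency twin
of utd-p3 g1's `wildKolyvaginUpperAtThree_of_globalDivisibility` (p544141). Hence line `birth` closes Ko from
{`stub_minftyGeManin`, `kolyvagin`, MN Thm. 0.7}: its stub `stub_structure` (equality form, tower, class currency, no source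
in the tree) is SUPERSEDED by the upper half in print, and `stub_minftyFinite` (landed separately) is no longer load-bearing.
CONDITIONAL on the named facts where they appear as hypotheses; Ko, the refined Kolyvagin conjecture at `3` and BSD stay open.

References: [McCallumLMS1991] §4 (4)–(6), Cor. 4.5, §5 (`ord_p(P_n)`, Lemma 5.1, Cor. 5.6); [WZhang2014] §3.8, Notations
(xii); [GrossLMS1991] §3, Prop. 3.6, §4 (4.1), Lemma 4.3; [MatarNekovar2019] Thm. 0.7, §0.11; [Jetchev2008] Conj. 1.3.
-/

set_option autoImplicit false
set_option linter.dupNamespace false -- `Summit.BirchSwinnertonDyer.BirchSwinnertonDyer.…` is the tree's layout (D-0017)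

noncomputable section

open scoped Classical

namespace Summit.BirchSwinnertonDyer.BirchSwinnertonDyer.Theorems.WildKolyvaginUpperAtThreeOfMinftyGe

open WeierstrassCurve NumberField Field IsDedekindDomain Literature.NumberTheory.EllipticCurves
  Literature.NumberTheory.EllipticCurves.ModularForms
  Literature.NumberTheory.EllipticCurves.KolyvaginCocycle
  Literature.NumberTheory.EllipticCurves.Rank1Residual
  Summit.BirchSwinnertonDyer.Rank1Residual
  Summit.BirchSwinnertonDyer.Rank1Residual.Additive
  Summit.BirchSwinnertonDyer.Rank1Residual.X11b
  Summit.BirchSwinnertonDyer.Rank1Residual.X11b.Three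
  Summit.BirchSwinnertonDyer.BirchSwinnertonDyer.Theses.SemiOrdinaryEisensteinDescent
  Summit.BirchSwinnertonDyer.BirchSwinnertonDyer.Theorems.SchneiderFree

/-! ## §1 Class currency ⟹ point currency -/

/-- **A `3^t`-divisible class of level `M ≤ t` is zero**: `H¹(K, E[3^M])` is killed by `3^M`
(`zsmul_galH1Torsion_eq_zero`), so `ClassDivisibleBy d M t` with `M ≤ t` forces `c_M(n) = 0`. [folklore] -/
theorem kolyvaginClass_eq_zero_of_classDivisibleBy
    {W : WeierstrassCurve ℚ} {K : Type} [Field K] [NumberField K] {N : ℕ} [NeZero N]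
    {Dt : ModularParametrizationData W N} {β : ℤ} {ι : K →+* ℂ} {n : ℕ} (d : KolyvaginHeegnerData Dt β ι n)
    {M t : ℕ} (hMt : M ≤ t) (h : AdditiveThree.ClassDivisibleBy d M t) :
    d.kolyvaginClass Nat.prime_three M = 0 := by
  obtain ⟨x, hx⟩ := h
  have hM : (3 ^ M) • x = 0 := by
    rw [← natCast_zsmul]
    exact zsmul_galH1Torsion_eq_zero (W.baseChange K) _ x
  have hts : 3 ^ t = 3 ^ (t - M) * 3 ^ M := by rw [← pow_add, Nat.sub_add_cancel hMt]
  rw [hx, hts, mul_smul, hM, smul_zero]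

/-- **`d_K < −4` on the crux's frames**: an imaginary quadratic `K` with `d_K` odd, `d_K ≠ −3` and an orientation
`4N ∣ β² − d_K` has `d_K ≡ 1 (mod 4)`, hence `d_K ≤ −7`. (The order `ℓ + 1` of `Gal(K[ℓ]/K[1])` and the tree's
invariance theorem at Zhang–Kolyvagin levels use `d_K < −4`.) [folklore] -/
theorem discr_lt_neg_four_of_odd {K : Type} [Field K] [NumberField K] (hK : IsImaginaryQuadratic K)
    (hodd : Odd (NumberField.discr K)) (h3 : NumberField.discr K ≠ -3) {N : ℕ} {β : ℤ}
    (hβ : (4 * N : ℤ) ∣ β ^ 2 - NumberField.discr K) : NumberField.discr K < -4 := by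
  have hneg : NumberField.discr K < 0 := hK.discr_neg
  obtain ⟨k, hk⟩ : (4 : ℤ) ∣ β ^ 2 - NumberField.discr K := dvd_trans ⟨N, by ring⟩ hβ
  obtain ⟨a, ha⟩ := hodd
  rcases Int.even_or_odd β with ⟨b, hb⟩ | ⟨b, hb⟩
  · have h2 : β ^ 2 = 4 * (b * b) := by rw [hb]; ring
    omega
  · have h2 : β ^ 2 = 4 * (b * b + b) + 1 := by rw [hb]; ring
    omega

/-- **CLASS ⟹ POINT at one datum** (McCallum 1991 Cor. 4.5 read at the level `M = s'`): for `K` imaginary quadratic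
Heegner for `N_E` with `d_K < −4`, `ρ̄_{E,3}` onto, a frame `(Dt, β, ι)`, and `M_∞ ≥ t` in class currency
(`AdditiveThree.MinftyGe W K Dt β ι t`): every Kolyvagin–Heegner datum `d` at a square-free product `n` of
Zhang–Kolyvagin primes of index `≥ s'`, `s' ≤ t`, has `3^{s'} ∣ P(n)` in `E(K[n])` (`Koly.PDiv d 3 s'`). The class
`c_{s'}(n)` vanishes (`kolyvaginClass_eq_zero_of_classDivisibleBy`) and is genuine — admissibility from `ρ̄_{E,3}` onto,
invariance from the Euler-system relations at the lower levels, whose data exist by the discharged Gross §3 facts —, so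
Cor. 4.5 applies. Unconditional. [cite: McCallumLMS1991, §4 Cor. 4.5 and (4)] [cite: GrossLMS1991, §3 and Prop. 3.6]
[cite: WZhang2014, §3.8 (𝓜(n)) and Notations (xii)] -/
theorem pDiv_of_minftyGe
    (W : WeierstrassCurve ℚ) [W.IsElliptic] [W.IsGloballyMinimal] [NeZero (W.conductorNorm ℤ)]
    (K : Type) [Field K] [NumberField K] (hK : IsImaginaryQuadratic K)
    (hHH : SatisfiesHeegnerHypothesis (W.conductorNorm ℤ) K) (hD : NumberField.discr K < -4)
    (hsurj : W.HasSurjectiveModNGaloisRep 3)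
    (Dt : ModularParametrizationData W (W.conductorNorm ℤ)) (β : ℤ) (ι : K →+* ℂ)
    {t : ℕ} (ht : AdditiveThree.MinftyGe W K Dt β ι t) {s' : ℕ} (hs' : s' ≤ t)
    {n : ℕ} (d : KolyvaginHeegnerData Dt β ι n) (hn : Squarefree n)
    (hkol : ∀ ℓ ∈ n.primeFactors,
      Zhang2014.IsKolyvaginPrime (W.conductorNorm ℤ) W K 3 ℓ ∧ s' ≤ Zhang2014.kolyvaginIndex W 3 ℓ) :
    Koly.PDiv d 3 s' := by
  haveI : Fact (Nat.Prime 3) := ⟨Nat.prime_three⟩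
  by_cases hs0 : s' = 0
  · subst hs0
    exact ⟨d.derivedPoint, by rw [pow_zero, Nat.cast_one, one_zsmul]⟩
  have h1 : 1 ≤ s' := Nat.one_le_iff_ne_zero.mpr hs0
  -- the class `c_{s'}(n)` is `3^t`-divisible, hence zero
  have hsupp : KolyvaginDescent.KolSupp (Zhang2014.IsKolyvaginPrime (W.conductorNorm ℤ) W K 3) n :=
    ⟨hn, fun q hq ↦ (hkol q hq).1⟩
  have hlev : ((s' : ℕ) : ℕ∞) ≤ Zhang2014.levelIndex W 3 n :=
    Zhang2014.natCast_le_levelIndex_iff.mpr fun ℓ hℓ ↦ (hkol ℓ hℓ).2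
  have hzero : d.kolyvaginClass Nat.prime_three s' = 0 :=
    kolyvaginClass_eq_zero_of_classDivisibleBy d hs' (ht n d s' hsupp h1 hlev)
  -- `(N, d_K) = 1` from the Heegner hypothesis
  have hND : IsCoprime (W.conductorNorm ℤ : ℤ) (NumberField.discr K) := by
    have h := Literature.SatisfiesHeegnerHypothesis.coprime_discr hK.1 hHH
    refine Int.isCoprime_iff_gcd_eq_one.mpr ?_
    rw [Int.gcd_eq_natAbs, Int.natAbs_natCast]
    exact h
  -- Kolyvagin–Heegner data at every level `m ∣ n` (Gross 1991 §3, discharged), with `d` itself on top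
  have hinert : ∀ m : ℕ, m ∣ n → ∀ q ∈ m.primeFactors, (Ideal.span {(q : 𝓞 K)}).IsPrime :=
    fun m hm q hq ↦ (hkol q (Nat.primeFactors_mono hm hn.ne_zero hq)).1.2.2.2.2.1
  have hKD : ∀ m : ℕ, m ∣ n → Nonempty (KolyvaginHeegnerData Dt β ι m) := fun m hm ↦
    nonempty_kolyvaginHeegnerData_of_grossCM
      (phi_heegnerPointOfConductor_mem_range_map_ringClassField_holds (W.conductorNorm ℤ) W K)
      exists_generator_ringClassGalOver_holds hK hHH Dt β ι d.dvd_sq_sub (hn.squarefree_of_dvd hm)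
      (hinert m hm)
  let dd : (m : ℕ) → m ∣ n → KolyvaginHeegnerData Dt β ι m := fun m hm ↦
    if h : m = n then h ▸ d else Classical.choice (hKD m hm)
  have hdd : dd n dvd_rfl = d := by
    show (if h : n = n then h ▸ d else _) = d
    rw [dif_pos rfl]
  -- invariance of `[P(n)]` mod `3^{s'}` (McCallum (4) / Gross Prop. 3.6 at Zhang–Kolyvagin levels of index `≥ s'`)
  have hinv := KolyCert.toGeomPoints_derivedPoint_mem_invPoints_of_dvd_zhang hK ι Dt Nat.prime_three hND hD hn
    hkol dd n dvd_rfl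
  rw [hdd] at hinv
  -- admissibility of `E(K[n]) ⊆ E(K̄)` for `3^{s'}` (Gross Lemma 4.3 from `ρ̄_{E,3}` onto), then McCallum Cor. 4.5
  have hA := RingClassNoTorsion.isAdmissible_pointsSubgroup_three d hK hn.ne_zero hsurj s'
  exact (KolyCert.kolyvaginClass_eq_zero_iff_pDiv d Nat.prime_three s' hA hinv).mp hzero

/-- **CLASS ⟹ POINT, global form on one frame**: `M_∞ ≥ t` in class currency gives the displayed global-divisibility
hypothesis `hglob` of the receptacles (`SchneiderFree.Exact.upper_of_globalDivisibility_of_surj`, Matar–Nekovář Thm. 0.7 as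
typed) to the same depth `t`, in point currency. [cite: McCallumLMS1991, §4 Cor. 4.5] [cite: WZhang2014, §3.8] -/
theorem globalDivisibility_of_minftyGe
    (W : WeierstrassCurve ℚ) [W.IsElliptic] [W.IsGloballyMinimal] [NeZero (W.conductorNorm ℤ)]
    (K : Type) [Field K] [NumberField K] (hK : IsImaginaryQuadratic K)
    (hHH : SatisfiesHeegnerHypothesis (W.conductorNorm ℤ) K) (hD : NumberField.discr K < -4)
    (hsurj : W.HasSurjectiveModNGaloisRep 3)
    (Dt : ModularParametrizationData W (W.conductorNorm ℤ)) (β : ℤ) (ι : K →+* ℂ)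
    {t : ℕ} (ht : AdditiveThree.MinftyGe W K Dt β ι t) :
    ∀ (s' : ℕ), s' ≤ t → ∀ (n : ℕ) (d : KolyvaginHeegnerData Dt β ι n), Squarefree n →
      (∀ ℓ ∈ n.primeFactors, Zhang2014.IsKolyvaginPrime (W.conductorNorm ℤ) W K 3 ℓ ∧
        s' ≤ Zhang2014.kolyvaginIndex W 3 ℓ) → Koly.PDiv d 3 s' :=
  fun _ hs' _ d hn hkol ↦ pDiv_of_minftyGe W K hK hHH hD hsurj Dt β ι ht hs' d hn hkol

/-! ## §2 The socket and the crux BY NAME from the class-currency divisibility + print -/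

/-- **co-STEP L at slack `s` from `M_∞ ≥ ord₃ ∏ c_ℓ + s` (class currency) + Kolyvagin 1990 + Matar–Nekovář 2019 Thm. 0.7.**
On one frame of the crux (`K` imaginary quadratic Heegner for `N_E`, `d_K` odd, `d_K ≠ −3`, `ρ̄_{E,3}` onto, `P ∈ E(K)` with
`ι(P) = heegnerPointComplex Dt H` of infinite order): `AdditiveThree.MinftyGe W K Dt H.β ι (ord₃ ∏ c_ℓ(E) + s)` ⟹
`Upper.IndexUpperBoundLeAt W 3 K P s`, through `globalDivisibility_of_minftyGe` and utd-p3 g1's tower-free receptacle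
`SchneiderFree.Exact.upper_of_globalDivisibility_of_surj` (p542530). CONDITIONAL on the named facts `kolyvagin` (Kolyvagin
1990 Thm. A) and `MatarNekovar2019.thm07_…` (Kolyvagin's structure theorem, upper half, irreducible image, no reduction
binder), taken as hypotheses. [cite: MatarNekovar2019, Thm. 0.7 (p. 456) and §0.11 (p. 457)]
[cite: McCallumLMS1991, §5 Cor. 5.6 (p. 310)] -/
theorem upper_of_minftyGe_of_surj
    (hKo : ∀ (N : ℕ) [NeZero N] (W : WeierstrassCurve ℚ) (K : Type) [Field K] [NumberField K],
      kolyvagin N W K)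
    (hMN : MatarNekovar2019.thm07_padicValNat_card_sha_primary_add_le_of_globalDivisibility_of_irreducible)
    (W : WeierstrassCurve ℚ) [W.IsElliptic] [W.IsGloballyMinimal] [NeZero (W.conductorNorm ℤ)]
    (hsurj : W.HasSurjectiveModNGaloisRep 3)
    (K : Type) [Field K] [NumberField K] (hK : IsImaginaryQuadratic K)
    (hodd : Odd (NumberField.discr K)) (h3 : NumberField.discr K ≠ -3)
    (hHH : SatisfiesHeegnerHypothesis (W.conductorNorm ℤ) K)
    (Dt : ModularParametrizationData W (W.conductorNorm ℤ))
    (H : HeegnerDatum (W.conductorNorm ℤ) (NumberField.discr K)) (ι : K →+* ℂ)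
    (P : (W.baseChange K).toAffine.Point)
    (hP : WeierstrassCurve.Affine.Point.map ι.toRatAlgHom P = heegnerPointComplex Dt H)
    (hnt : ¬ IsOfFinAddOrder P) {s : ℕ}
    (ht : AdditiveThree.MinftyGe W K Dt H.β ι (padicValNat 3 W.tamagawaProduct + s)) :
    Upper.IndexUpperBoundLeAt W 3 K P s := by
  haveI : Fact (Nat.Prime 3) := ⟨Nat.prime_three⟩
  have hD : NumberField.discr K < -4 := discr_lt_neg_four_of_odd hK hodd h3 H.dvd_sq_sub
  have h4 : NumberField.discr K ≠ -4 := by omega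
  exact Exact.upper_of_globalDivisibility_of_surj hKo hMN W 3 (by decide) hsurj K hK h3 h4 hHH Dt H ι P hP hnt
    (globalDivisibility_of_minftyGe W K hK hHH hD hsurj Dt H.β ι ht)

/-- **Crux Ko `WildKolyvaginUpperAtThree` ⟸ `stub_minftyGeManin` (class currency, VERBATIM as registered on line `birth`)
+ Kolyvagin 1990 (named) + Matar–Nekovář 2019 Thm. 0.7/§0.11 (named).** The class-currency twin of
`WildKolyvaginUpperAtThreeOfGlobalDivisibility.wildKolyvaginUpperAtThree_of_globalDivisibility` (p544141): with EXACTLY the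
crux's binders, the Manin-robust Jetchev direction `M_∞ ≥ ord₃ ∏ c_q + v₃ c(Dt)` of the refined Kolyvagin conjecture at the
additive prime `3` (`hM`, displayed; NOT in print) gives, through `globalDivisibility_of_minftyGe` and the receptacle, the
socket `Upper.IndexUpperBoundLeAt W 3 K P (v₃ c)` — the crux's conclusion. The binders `ClassO6`, `r_an = 1`,
`TowerSurjThree` are passed to `hM` and otherwise idle. CONDITIONAL on `hKo`, `hMN`, `hM`; Ko, the conjecture and BSD stay
open. [cite: Jetchev2008, Conj. 1.3 (p. 812)] [cite: MatarNekovar2019, Thm. 0.7 (p. 456) and §0.11 (p. 457)] -/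
theorem wildKolyvaginUpperAtThree_of_minftyGeManin
    (hKo : ∀ (N : ℕ) [NeZero N] (W : WeierstrassCurve ℚ) (K : Type) [Field K] [NumberField K],
      kolyvagin N W K)
    (hMN : MatarNekovar2019.thm07_padicValNat_card_sha_primary_add_le_of_globalDivisibility_of_irreducible)
    (hM : ∀ (W : WeierstrassCurve ℚ) [W.IsElliptic] [W.IsGloballyMinimal],
      Summit.BirchSwinnertonDyer.Rank1Residual.Additive.ClassO6 W 3 → W.HasSurjectiveModNGaloisRep 3 →
      W.analyticRank = 1 → Summit.BirchSwinnertonDyer.Rank1Residual.AdditiveThree.TowerSurjThree W →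
      ∀ (K : Type) [Field K] [NumberField K], Literature.NumberTheory.EllipticCurves.IsImaginaryQuadratic K →
      Odd (NumberField.discr K) → NumberField.discr K ≠ -3 → ∀ [NeZero (W.conductorNorm ℤ)],
      Literature.NumberTheory.EllipticCurves.SatisfiesHeegnerHypothesis (W.conductorNorm ℤ) K →
      (W.quadraticTwist (NumberField.discr K : ℚ)).entireLFunction 1 ≠ 0 →
      ∀ (Dt : Literature.NumberTheory.EllipticCurves.ModularForms.ModularParametrizationData W (W.conductorNorm ℤ))
        (H : Literature.NumberTheory.EllipticCurves.HeegnerDatum (W.conductorNorm ℤ) (NumberField.discr K))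
        (ι : K →+* ℂ) (P : (W.baseChange K).toAffine.Point),
      (WeierstrassCurve.Affine.Point.map ι.toRatAlgHom) P =
        Literature.NumberTheory.EllipticCurves.ModularForms.heegnerPointComplex Dt H →
      ¬ IsOfFinAddOrder P →
      Summit.BirchSwinnertonDyer.Rank1Residual.AdditiveThree.MinftyGe W K Dt H.β ι
        (padicValNat 3 W.tamagawaProduct + padicValNat 3 Dt.c.natAbs)) :
    WildKolyvaginUpperAtThree := by
  intro W _ _ N _ K _ _ Dt H ι P hO6 hsurj hr hN hK hHH hLd hP hnt hodd h3 htower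
  subst hN
  exact upper_of_minftyGe_of_surj hKo hMN W hsurj K hK hodd h3 hHH Dt H ι P hP hnt
    (hM W hO6 hsurj hr htower K hK hodd h3 hHH hLd Dt H ι P hP hnt)

end Summit.BirchSwinnertonDyer.BirchSwinnertonDyer.Theorems.WildKolyvaginUpperAtThreeOfMinftyGe

end
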